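import Mathlib
import HarnessLib
import Summits.CriticalPhenomena.Ising3DConformalLimit.Theses.FKParityRobustness
import Literature.Probability.LatticeModels.LoopO1

/-!
# Crux-ideate sketches for `StrandShadow` (item stmt-CriticalPhenomena-14626), ideator 3, round 1

First lemmas of the two crux-idea cards

* `density-floor-epsilon-exchange` — DensityFloor, SingleEdgeDeficit (finite-graph, provable now),
  the residual `EpsilonExchangeFloor`, and the route's foreseen child `LinearResponseFloorMean`;
* `overlap-fkg-anticorrelation` — the overlap field `q = σσ'` of two independent copies:
  `OverlapLatticeCondition` (FKG lattice condition, provable now), `OverlapUrsellIdentity`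
  (`U₄ = 8·Cov_{μ_q}(X,Y)`), and the transfer target `OverlapAnticorrelation`.

Nothing is proved here (crux-ideate: no skeleton); every `Prop` elaborates over tree declarations.
-/

namespace Summit.CriticalPhenomena.Ising3DConformalLimit.Cruxes.StrandShadow.Ideator3

open scoped BigOperators Classical symmDiff
open MeasureTheory Finset Literature.Probability.LatticeModels Literature.Probability

/-- The tetrahedral shape of the route (even corners of the cube `[-1,1]³`). -/
def tetra : Fin 4 → Site 3 := ![![-1, -1, -1], ![1, 1, -1], ![1, -1, 1], ![-1, 1, 1]]

/-! ## Card `density-floor-epsilon-exchange` -/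

/-- Truncated pair–bond correlation `⟨σ_A ; σ_uσ_v⟩^{free}_{G,β} = ⟨σ_A σ_u σ_v⟩ - ⟨σ_A⟩⟨σ_uσ_v⟩`
(the symmetric difference implements `σ² = 1`). Nonnegative by GKS II. -/
noncomputable def bondResponse {V : Type*} [Fintype V] [DecidableEq V] (G : SimpleGraph V)
    [DecidableRel G.Adj] (β : ℝ) (A : Finset V) (u v : V) : ℝ :=
  isingCorr G univ β 0 .free (A ∆ {u, v}) - isingCorr G univ β 0 .free A * isingCorr G univ β 0 .free {u, v}

/-- **DensityFloor** (the lever; finite graph, provable now).  For the sourced loop-O(1) measure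
`ℓ^{xy}_{G,t}`, `t = tanh β`, and every edge `e = uv` of `G`:
`ℓ^{xy}[e ∈ K_x(F)] ≥ ℓ^{xy}[e ∈ F] - ℓ^{∅}[e ∈ F] = (t/(1-t²))·⟨σ_xσ_y ; σ_uσ_v⟩_G / ⟨σ_xσ_y⟩_G`,
where `K_x(F)` is the `F`-component of the source `x`.  Written multiplied out with
`⟨σ_xσ_y⟩ = Z^{xy}_t / Z^{∅}_t`:  `(t/(1-t²))·⟨σ_xσ_y;σ_e⟩·Z^{∅}_t ≤ Σ_{F ∈ 𝒯_{xy}, e ∈ K_x(F)} t^{|F|}`.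
Proof: `F ↦ (K, F ∖ K)` (cluster bijection of the route's `DepletionBound`), `ℓ^{∅}_{G'}[e ∈ F] =
t(⟨σ_e⟩_{G'} - t)/(1-t²)` for `G' = G - V(K) ⊆ G`, GKS II `⟨σ_e⟩_{G'} ≤ ⟨σ_e⟩_G`, and
`ℓ^{xy}[e∈F] - ℓ^{∅}[e∈F] = t∂_{t_e} log⟨σ_xσ_y⟩`. -/
def DensityFloor : Prop :=
  ∀ (V : Type) [Fintype V] [DecidableEq V] (G : SimpleGraph V) [DecidableRel G.Adj] (β : ℝ), 0 ≤ β →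
    ∀ (x y u v : V), x ≠ y → G.Adj u v →
    (let t : ℝ := Real.tanh β
     t / (1 - t ^ 2) * bondResponse G β {x, y} u v * loopO1PartitionFunction G t ∅ ≤
       ∑ F ∈ (tJoins G Set.univ {x, y}).filter
            (fun F : Finset (Sym2 V) => s(u, v) ∈ F ∧ (SimpleGraph.fromEdgeSet (↑F : Set (Sym2 V))).Reachable x u),
          t ^ F.card)

/-- **SingleEdgeDeficit** (exact one-bond deletion calculus, provable now): deleting the edge
`f = uv` from `G` lowers `⟨σ_aσ_b⟩` by `t·⟨σ_aσ_b;σ_f⟩_G·(1 + t⟨σ_f⟩_{G-f})/(1-t²)`, hence by an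
amount in `[t/(1-t²), t/(1-t)]·⟨σ_aσ_b ; σ_f⟩_G` (response evaluated BEFORE the deletion). -/
def SingleEdgeDeficit : Prop :=
  ∀ (V : Type) [Fintype V] [DecidableEq V] (G : SimpleGraph V) [DecidableRel G.Adj] (β : ℝ), 0 ≤ β →
    ∀ (a b u v : V), G.Adj u v →
    (let t : ℝ := Real.tanh β
     let H : SimpleGraph V := G.deleteEdges {s(u, v)}
     t / (1 - t ^ 2) * bondResponse G β {a, b} u v ≤
         isingCorr G univ β 0 .free {a, b} - isingCorr H univ β 0 .free {a, b} ∧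
       isingCorr G univ β 0 .free {a, b} - isingCorr H univ β 0 .free {a, b} ≤
         t / (1 - t) * bondResponse G β {a, b} u v)

/-- **EpsilonExchangeFloor** (residual crux, energy sector; route frame).  The ε-exchange
diagram between the opposite edges of the tetrahedron does not vanish:
`Ξ_N(l) := Σ_{e} ⟨σ_{a₀}σ_{a₁};σ_e⟩⟨σ_{a₂}σ_{a₃};σ_e⟩ / (G₀₁G₂₃) ≥ c` uniformly in `l`
(each edge counted twice through ordered pairs). Physics: `Ξ ≍ l^{3-2Δ_ε} = l^{2y_t-3} = l^{0.175}`;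
bounded below iff `Δ_ε ≤ 3/2` iff `ν ≤ 2/3` iff `α ≥ 0`; `→ 0` for `d ≥ 5` and for the
`α < 3/2` long-range models on `ℤ³` (`Δ_ε = 3 - α > 3/2`). -/
def EpsilonExchangeFloor : Prop :=
  ∃ c : ℝ, 0 < c ∧ ∀ l : ℕ, 1 ≤ l → ∃ N₀ : ℕ, ∀ N : ℕ, N₀ ≤ N → ∀ a : Fin 4 → ↥(box 3 N),
    (∀ i, ((a i : Site 3)) = (l : ℤ) • tetra i) →
    (let G := ((zdGraph 3).comap (Subtype.val : ↥(box 3 N) → Site 3))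
     let β : ℝ := criticalBeta 3
     c * isingCorr G univ β 0 .free {a 0, a 1} * isingCorr G univ β 0 .free {a 2, a 3} ≤
       ∑ u, ∑ v, if G.Adj u v then bondResponse G β {a 0, a 1} u v * bondResponse G β {a 2, a 3} u v else 0)

/-- **LinearResponseFloorMean** (the route's foreseen child `LinearResponseFloor` of `StrandShadow`,
first-moment form): averaged over `F ~ ℓ^{a₀a₁}_N`, the relative energy response of
`⟨σ_{a₂}σ_{a₃}⟩` summed over the bonds at the source cluster `V(K_{a₀}(F))` is `≥ c`:
`Σ_F t^{|F|} Σ_{uv ∈ E(G_N), u ∈ V(K_{a₀}(F))} ⟨σ₂σ₃;σ_uσ_v⟩ ≥ c·Z^{01}·⟨σ₂σ₃⟩`. -/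
def LinearResponseFloorMean : Prop :=
  ∃ c : ℝ, 0 < c ∧ ∀ l : ℕ, 1 ≤ l → ∃ N₀ : ℕ, ∀ N : ℕ, N₀ ≤ N → ∀ a : Fin 4 → ↥(box 3 N),
    (∀ i, ((a i : Site 3)) = (l : ℤ) • tetra i) →
    (let G := ((zdGraph 3).comap (Subtype.val : ↥(box 3 N) → Site 3))
     let β : ℝ := criticalBeta 3
     let t : ℝ := Real.tanh β
     c * loopO1PartitionFunction G t {a 0, a 1} * isingCorr G univ β 0 .free {a 2, a 3} ≤
       ∑ F ∈ tJoins G Set.univ {a 0, a 1}, t ^ F.card *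
         ∑ u, ∑ v, if G.Adj u v ∧ (SimpleGraph.fromEdgeSet (↑F : Set (Sym2 ↥(box 3 N)))).Reachable (a 0) u
           then bondResponse G β {a 2, a 3} u v else 0)

/-- First implication of the line (provable now, size S–M: sum DensityFloor against the
GKS-nonnegative responses `⟨σ₂σ₃;σ_e⟩`, keep only the cluster's own edges `K ⊆ E(V(K))`, and use
`ℓ^{01}[e∈K]·⟨σ₂σ₃;σ_e⟩` summed = `(t/(1-t²))·Ξ·G₂₃/…`). -/
theorem linearResponseFloorMean_of_exchange :
    DensityFloor → EpsilonExchangeFloor → LinearResponseFloorMean := by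
  sorry

/-! ## Card `overlap-fkg-anticorrelation` -/

section Overlap

variable {V : Type*} [Fintype V] [DecidableEq V] (G : SimpleGraph V) [DecidableRel G.Adj]

/-- Unnormalised law of the overlap set `S = {x | σ_x = σ'_x}` of two independent copies of the
zero-field free Ising model on `G` at `β`:  `w(S) = Z_{2β}(G[S]) · Z_{2β}(G[V∖S])`
(given `q = σσ'`, `σ` is an Ising model at `2β` on the equal-`q` edges, which decouples into the
induced subgraphs on `S` and `Sᶜ`). -/
noncomputable def overlapWeight (β : ℝ) (S : Finset V) : ℝ :=
  isingPartitionFunction G S (2 * β) 0 .free * isingPartitionFunction G Sᶜ (2 * β) 0 .free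

/-- The `+`-side conductance `X(S) = 1[a₀,a₁ ∈ S]·⟨σ_{a₀}σ_{a₁}⟩^{free}_{G[S],2β}` (increasing in `S`:
indicator and GKS II) — `E[s_{a₀}s_{a₁} | q] / 4` for `s = σ + σ'`. -/
noncomputable def plusConductance (β : ℝ) (a₀ a₁ : V) (S : Finset V) : ℝ :=
  if a₀ ∈ S ∧ a₁ ∈ S then isingCorr G S (2 * β) 0 .free {a₀, a₁} else 0

/-- The `-`-side conductance `Y(S) = 1[a₂,a₃ ∉ S]·⟨σ_{a₂}σ_{a₃}⟩^{free}_{G[Sᶜ],2β}` (decreasing in `S`)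
— `E[t_{a₂}t_{a₃} | q] / 4` for `t = σ - σ'`. -/
noncomputable def minusConductance (β : ℝ) (a₂ a₃ : V) (S : Finset V) : ℝ :=
  if a₂ ∉ S ∧ a₃ ∉ S then isingCorr G Sᶜ (2 * β) 0 .free {a₂, a₃} else 0

end Overlap

/-- **OverlapLatticeCondition** (first lemma, provable now): `S ↦ w(S)` is log-supermodular,
`w(S ∪ S')·w(S ∩ S') ≥ w(S)·w(S')` — the FKG lattice condition (Holley) for the overlap field of
two i.i.d. ferromagnetic Ising copies on any finite graph, any `β ≥ 0`.  Proof: `log Z^{free}_{2β}(G[S])`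
is supermodular in `S` (`∂² log Z/∂J_e∂J_f = ⟨σ_e;σ_f⟩ ≥ 0`, GKS II; extra edges between `S∖S'`
and `S'∖S` only increase `Z`, GKS I), applied to `S` and to the complements. -/
def OverlapLatticeCondition : Prop :=
  ∀ (V : Type) [Fintype V] [DecidableEq V] (G : SimpleGraph V) [DecidableRel G.Adj] (β : ℝ), 0 ≤ β →
    ∀ S S' : Finset V,
      overlapWeight G β S * overlapWeight G β S' ≤ overlapWeight G β (S ∪ S') * overlapWeight G β (S ∩ S')

/-- **OverlapUrsellIdentity** (bookkeeping, provable now): with `W = Σ_S w(S)`,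
`E[X] = ⟨σ_{a₀}σ_{a₁}⟩/2`, `E[Y] = ⟨σ_{a₂}σ_{a₃}⟩/2`, and
`U₄(a₀,a₁,a₂,a₃) = 8·(E[XY] - E[X]E[Y])` (from `⟨s₀s₁t₂t₃⟩ - ⟨s₀s₁⟩⟨t₂t₃⟩ = 2U₄`, Lebowitz 1974 /
Sylvester); hence Lebowitz `U₄ ≤ 0` is the FKG inequality of `OverlapLatticeCondition` for the
increasing `X` and decreasing `Y`. Verified by exact enumeration (toy/exact_checks.out). -/
def OverlapUrsellIdentity : Prop :=
  ∀ (V : Type) [Fintype V] [DecidableEq V] (G : SimpleGraph V) [DecidableRel G.Adj] (β : ℝ), 0 ≤ β →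
    ∀ a : Fin 4 → V, Function.Injective a →
    (let w := overlapWeight G β
     let X := plusConductance G β (a 0) (a 1)
     let Y := minusConductance G β (a 2) (a 3)
     let W : ℝ := ∑ S : Finset V, w S
     (∑ S : Finset V, w S * X S) / W = isingCorr G univ β 0 .free {a 0, a 1} / 2 ∧
     (∑ S : Finset V, w S * Y S) / W = isingCorr G univ β 0 .free {a 2, a 3} / 2 ∧
     connectedFour (isingMeasure G univ β 0 .free) spinAt a =
       8 * ((∑ S : Finset V, w S * X S * Y S) / W -
            ((∑ S : Finset V, w S * X S) / W) * ((∑ S : Finset V, w S * Y S) / W)))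

/-- Structural payoff (provable now from the two facts above + Holley/FKG on the Boolean lattice,
Mathlib `four_functions_theorem` / `Finset.le_card_diffs_mul_card_diffs`-type inputs):
a new proof of Lebowitz' inequality `U₄ ≤ 0`. -/
theorem lebowitz_of_overlapLattice :
    OverlapLatticeCondition → OverlapUrsellIdentity →
      ∀ (V : Type) [Fintype V] [DecidableEq V] (G : SimpleGraph V) [DecidableRel G.Adj] (β : ℝ), 0 ≤ β →
        ∀ a : Fin 4 → V, Function.Injective a →
          connectedFour (isingMeasure G univ β 0 .free) spinAt a ≤ 0 := by
  sorry

/-- **OverlapAnticorrelation** (transfer target `C⁺`, route frame; EQUIVALENT to the lattice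
clause (iii) `|U₄(A_l)| ≥ 2c·G₀₁G₂₃` by `OverlapUrsellIdentity`, hence to `StrandShadow` by the
refuter's identity (★)): under the overlap field of two independent critical copies on `Λ_N`, the
`+`-conductance across `a₀a₁` and the `-`-conductance across `a₂a₃` are negatively correlated by a
uniform FRACTION: `E[X]E[Y] - E[XY] ≥ c·E[X]E[Y]`. -/
def OverlapAnticorrelation : Prop :=
  ∃ c : ℝ, 0 < c ∧ ∀ l : ℕ, 1 ≤ l → ∃ N₀ : ℕ, ∀ N : ℕ, N₀ ≤ N → ∀ a : Fin 4 → ↥(box 3 N),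
    (∀ i, ((a i : Site 3)) = (l : ℤ) • tetra i) →
    (let G := ((zdGraph 3).comap (Subtype.val : ↥(box 3 N) → Site 3))
     let β : ℝ := criticalBeta 3
     let w := overlapWeight G β
     let X := plusConductance G β (a 0) (a 1)
     let Y := minusConductance G β (a 2) (a 3)
     let W : ℝ := ∑ S : Finset ↥(box 3 N), w S
     (1 + c) * W * ∑ S : Finset ↥(box 3 N), w S * X S * Y S ≤
       (∑ S : Finset ↥(box 3 N), w S * X S) * (∑ S : Finset ↥(box 3 N), w S * Y S))

/-- The lattice clause (iii) at the tetrahedron, VERBATIM the standing disprover's `INT`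
(`Cruxes/StrandShadow/Disproof.lean` §4, 2026-08-16T05:01Z): `|U₄(A_l)| ≥ 2c·G₀₁G₂₃` in every large
free box. By the disprover's PROVED identity (★) (`pairSplitDeletionIdentity_holds`) and the `S₄`
stabiliser of `A_l`, `LatticeINT → StrandShadowClean` with constant `(2/3)c`. -/
def LatticeINT : Prop :=
  ∃ c : ℝ, 0 < c ∧ ∀ l : ℕ, 1 ≤ l → ∃ N₀ : ℕ, ∀ N : ℕ, N₀ ≤ N → ∀ a : Fin 4 → ↥(box 3 N),
    (∀ i, ((a i : Site 3)) = (l : ℤ) • tetra i) →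
    (let G := (zdGraph 3).comap (Subtype.val : ↥(box 3 N) → Site 3)
     let β : ℝ := criticalBeta 3
     let Gc : Fin 4 → Fin 4 → ℝ := fun i j => isingCorr G Finset.univ β 0 .free {a i, a j}
     2 * c * (Gc 0 1 * Gc 2 3) ≤
       Gc 0 1 * Gc 2 3 + Gc 0 2 * Gc 1 3 + Gc 0 3 * Gc 1 2 - isingCorr G Finset.univ β 0 .free (Finset.univ.image a))

/-- The REPAIRED crux `C′` (junk-free), VERBATIM the disprover's `StrandShadowClean` (§2; also the
rattack seat's repair): the sum restricted to configurations whose `a₀`-cluster swallows neither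
`a₂` nor `a₃`. `StrandShadow → StrandShadowClean` is proved there (`strandShadow_imp_clean`); the
converse needs the small-`l` junk estimate `J/(Z·G₂₃) ≈ 0.04` (Disproof §1, MC j013016), which is a
computation at the non-computable `β_c` — so every line of this crux should be glued to `C′`. -/
def StrandShadowClean : Prop :=
  ∃ c : ℝ, 0 < c ∧ ∀ l : ℕ, 1 ≤ l → ∃ N₀ : ℕ, ∀ N : ℕ, N₀ ≤ N → ∀ a : Fin 4 → ↥(box 3 N),
    (∀ i, ((a i : Site 3)) = (l : ℤ) • tetra i) →
    (let G := (zdGraph 3).comap (Subtype.val : ↥(box 3 N) → Site 3)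
     let β : ℝ := criticalBeta 3
     let t : ℝ := Real.tanh β
     (∑ F ∈ (tJoins G Set.univ {a 0, a 1}).filter (fun F : Finset (Sym2 ↥(box 3 N)) =>
          ¬ (SimpleGraph.fromEdgeSet (↑F : Set (Sym2 ↥(box 3 N)))).Reachable (a 0) (a 2) ∧
          ¬ (SimpleGraph.fromEdgeSet (↑F : Set (Sym2 ↥(box 3 N)))).Reachable (a 0) (a 3)),
        t ^ F.card * isingCorr G (Finset.univ.filter (fun v : ↥(box 3 N) =>
          ¬ (SimpleGraph.fromEdgeSet (↑F : Set (Sym2 ↥(box 3 N)))).Reachable (a 0) v)) β 0 .free {a 2, a 3})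
      ≤ (1 - c) * loopO1PartitionFunction G t {a 0, a 1} * isingCorr G Finset.univ β 0 .free {a 2, a 3})

/-- `C⁺ → INT` (provable now: `OverlapUrsellIdentity` is the bookkeeping `U₄ = 8·Cov`,
`E X = G₀₁/2`, `E Y = G₂₃/2`; at the symmetric tetrahedron all six `G_{ij}` agree). -/
theorem latticeINT_of_overlapAnticorrelation :
    OverlapUrsellIdentity → OverlapAnticorrelation → LatticeINT := by
  sorry

/-- `C⁺` reaches the repaired crux `C′` (glue = the previous theorem + the disprover's
`INT → StrandShadowClean`, Disproof.lean §4, constant `(2/3)c`). -/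
theorem strandShadowClean_of_overlapAnticorrelation :
    OverlapUrsellIdentity → OverlapAnticorrelation → (LatticeINT → StrandShadowClean) →
      StrandShadowClean :=
  fun hU hC hglue => hglue (latticeINT_of_overlapAnticorrelation hU hC)

/-- … and the crux BY NAME, with the junk step of the formal statement isolated as the named
hypothesis `StrandShadowClean → StrandShadow` (true numerically, Disproof §1; not provable without
a small-`l` estimate at `β_c`; the tenure planner is advised by both refuters to restate the item
as `C′`, after which this hypothesis disappears). -/
theorem strandShadow_of_overlapAnticorrelation :
    OverlapUrsellIdentity → OverlapAnticorrelation → (LatticeINT → StrandShadowClean) →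
      (StrandShadowClean → Theses.FKParityRobustness.StrandShadow) →
        Theses.FKParityRobustness.StrandShadow :=
  fun hU hC hglue hjunk => hjunk (strandShadowClean_of_overlapAnticorrelation hU hC hglue)

end Summit.CriticalPhenomena.Ising3DConformalLimit.Cruxes.StrandShadow.Ideator3
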